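/-
Copyright: the b2b-balaban cell (near-miss cell 7), T⁴-continuum fan-out; row NE7b ROUND-2 swarm, seat
t4-ne7b-formalise-leaf-10 (gen 3; rows S6g′(f) + S1c of `t4/b2b-balaban-t4-ne7b-p1/LEAVES-NE7b.md`, owner's rulings
R-OWNER-22-12 (2), 22-18, 22-19).  Released under the licence of the surrounding project.
-/
import Summits.QuantumFields.BalabanUV.T4Continuum.Support.HistorySiblingEntropyCanon

/-!
# Sibling entropy bound — ON PEDIGREES WRITTEN CANONICALLY: the END with NO order display, only the three writing
# conventions `HeadOldest` + `TailSortedR` + `RenewDated` (rows S6g′(f) × S1c, file 2)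

Summits-side support leaf of the T⁴-continuum cell (rung (B)+1 on a FINITE torus only; NOT infinite volume, NOT the
mass gap, NOT the Clay statement; NOT a proof of the spine estimate NE7b).  Row NE7b, route «COUNT»; sequel of
`HistorySiblingEntropyCanon`.  [folklore] well-founded recursion over the pedigree's steps; nothing is quoted from
print, nothing printed is asserted, no `[cite:]` tag, no `Prop` fact minted.

WHAT.  Two READING CONVENTIONS of a pedigree (parametrised predicates on OUR data, of the same kind as
`Pedigree.HeadOldest`): **`TailSortedR c`** — the younger parts of `c` are listed in the order of their RECORDED SHAPES
(`enc ∘ toShapeR` of their flat genealogies); **`RenewDated`** — a renewed old part is a component of the PREVIOUS step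
(`RealisedDomains.renew_step`'s sentence).  Then `closed_gen` (an older component's flat genealogy is one cluster part at
any later step), **`canon_gen : (∀ c, P.HeadOldest c) → (∀ c, P.TailSortedR c) → P.RenewDated → Canon (P.gen c)`**,
`mono_gen`, and the END **`ENT_leR_gen`**:
`ENT PEv.step (P.gen c) ≤ 2·bsum (1 + fat) (P.gen c) + 4·partnerAges + 8·mrg + 8·NR` — the sibling-entropy residual of
the zone-form count (`HistoryJoinsEntropyBudget.budgetE`, leaf-05 g2) discharged on the FLAT genealogy of every
component of a canonically written pedigree, with NO `ShapeSorted`∕`InjParts*` display.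

WHY THIS IS THE RIGHT INTERFACE.  Any history CAN be written with its clusters' younger parts in recorded-shape order —
PROVIDED the realisation clause does not constrain that order; `HistoryRealise.Realises`' same-step join clause is a
PREFIX-contact chain (order-sensitive), whence row S1c file 1 (the order-free clause `RealisesC`).  This file is
file 2: what the sorted listing buys.

HONEST SCOPE.  Conventions displayed, not derived; `NR` (renewal nodes) enters the budget by name.  NE7b NOT proved.
HONEST DEPENDENCY (cell): continuum YM on T⁴ ⇐ BetaPertH ∧ nine spine estimates (0/9 proved); BetaPertH ⇐ (D1) ∧
(D4) ∧ CAP+tail; G-an2-4 gates asym, D1 and NE2/3/4.  This file changes none of it.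
-/

open Finset
open Literature.MathematicalPhysics.QuantumFieldTheory.Balaban1983to89
open T4PersistenceDictionary T4PartnerMultiplicity T4BranchingRecordsGas
open Summit.QuantumFields.BalabanUV.T4Continuum.ZoneSkeleton
open Summit.QuantumFields.BalabanUV.T4Continuum.HistorySiblingEntropyBound
open Summit.QuantumFields.BalabanUV.T4Continuum.HistoryGen
open Summit.QuantumFields.BalabanUV.T4Continuum.HistoryJoins
open Summit.QuantumFields.BalabanUV.T4Continuum.HistoryJoinsAdm
open Summit.QuantumFields.BalabanUV.T4Continuum.HistoryJoinsBudget (mrg)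
open Summit.QuantumFields.BalabanUV.T4Continuum.HistoryJoinsEntropyBudget (ENT)

namespace Summit.QuantumFields.BalabanUV.T4Continuum.HistoryGen.Pedigree

variable {α π : Type*} (P : Pedigree α π)

open HistorySiblingEntropyBridge in
/-- **READING CONVENTION — YOUNGER PARTS IN RECORDED-SHAPE ORDER**: the tail of the part list of `c` is sorted by
`enc ∘ toShapeR` of the parts' flat genealogies. [folklore] -/
def TailSortedR (c : α) : Prop :=
  ∀ G Gs, P.partsGen c P.genT = G :: Gs →
    ((Gs.map (gmap Prod.fst)).map (toShapeR PEv.step PEv.fat)).Pairwise fun x y => enc x ≤ enc y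

/-- **READING CONVENTION — RENEWALS DATED**: a renewed old part is a component of the previous step. [folklore] -/
def RenewDated : Prop := ∀ c c', Part.old c' true ∈ P.parts c → P.step c' + 1 = P.step c

end Summit.QuantumFields.BalabanUV.T4Continuum.HistoryGen.Pedigree

namespace Summit.QuantumFields.BalabanUV.T4Continuum.HistorySiblingEntropyBridge

noncomputable section

open scoped Classical

variable {α π : Type*} (P : Pedigree α π)

/-- the flat genealogy, unfolded [folklore] -/
theorem gen_eq_gmap_join (c : α) : P.gen c = gmap Prod.fst (P.join c (P.partsGen c P.genT)) := by
  unfold Pedigree.gen; rw [Pedigree.genT_eq]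

/-- the flat merger labels of a component are the canonical ones [folklore] -/
theorem fst_comp_merLab (c : α) : (Prod.fst ∘ P.merLab c) = merL (P.step c) := by
  funext i; rfl

/-- **AN OLDER COMPONENT'S FLAT GENEALOGY IS ONE CLUSTER PART AT ANY LATER STEP.** [folklore] -/
theorem closed_gen (c : α) {s : ℕ} (hs : P.step c < s) :
    clusterParts PEv.step s (P.gen c) = [([], P.gen c)] := by
  rw [gen_eq_gmap_join]
  unfold Pedigree.partsGen
  cases hps : P.parts c with
  | nil => simp [Pedigree.join, gmap]
  | cons p ps =>
      rw [Pedigree.partsGenAux_cons]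
      cases ps with
      | nil =>
          simp only [Pedigree.partsGenAux_nil, Pedigree.join, chainMerge_nil]
          rcases p with ⟨c', _ | _⟩ | ⟨d, x⟩
          · have hlt := P.step_lt c c' false (by rw [hps]; exact List.mem_cons_self)
            have ih := closed_gen c' (lt_trans hlt hs)
            simpa [Pedigree.partGen, Pedigree.gen] using ih
          · simp [Pedigree.partGen, gmap]
          · simp [Pedigree.partGen, gmap]
      | cons p' ps' =>
          rw [Pedigree.partsGenAux_cons]
          simp only [Pedigree.join]
          rw [gmap_chainMerge, fst_comp_merLab]
          obtain ⟨X, Y, hXY⟩ := exists_chainMerge_eq_merge ((P.step c, 2, 0) : PEv)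
            (gmap Prod.fst (P.partGen c P.genT 0 p))
            ((P.partGen c P.genT (0 + 1) p' :: P.partsGenAux c P.genT (0 + 1 + 1) ps').map (gmap Prod.fst)) (by simp)
          rw [show merL (P.step c) = fun _ => ((P.step c, 2, 0) : PEv) from rfl, hXY]
          exact clusterParts_merge_of_ne PEv.step (by simp [PEv.step]; omega)
termination_by P.step c
decreasing_by exact hlt

/-- the flat genealogy of a part of `c`: canonical and closed at the step of `c` (given the conventions and the
canonicity of the older components) [folklore] -/
theorem canon_partGen (hR : P.RenewDated) (c : α) (ih : ∀ c', P.step c' < P.step c → Canon (P.gen c'))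
    (i : ℕ) (q : Part α π) (hq : q ∈ P.parts c) :
    Canon (gmap Prod.fst (P.partGen c P.genT i q)) ∧
      clusterParts PEv.step (P.step c) (gmap Prod.fst (P.partGen c P.genT i q)) =
        [([], gmap Prod.fst (P.partGen c P.genT i q))] := by
  rcases q with ⟨c', _ | _⟩ | ⟨d, x⟩
  · have hlt := P.step_lt c c' false hq
    simp only [Pedigree.partGen]
    exact ⟨ih c' hlt, closed_gen P c' hlt⟩
  · have hlt := P.step_lt c c' true hq
    have hd := hR c c' hq
    simp only [Pedigree.partGen, gmap]
    refine ⟨?_, by simp⟩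
    rw [← hd]
    exact Canon.renew _ _ (ih c' hlt)
  · simp only [Pedigree.partGen, gmap]
    exact ⟨Canon.born _ _, by simp⟩

/-- **THE FLAT GENEALOGY OF EVERY COMPONENT OF A CANONICALLY WRITTEN PEDIGREE IS CANONICAL.** [folklore] -/
theorem canon_gen (hH : ∀ c, P.HeadOldest c) (hS : ∀ c, P.TailSortedR c) (hR : P.RenewDated) (c : α) :
    Canon (P.gen c) := by
  have ih : ∀ c', P.step c' < P.step c → Canon (P.gen c') := fun c' _ => canon_gen hH hS hR c'
  have hpart := canon_partGen P hR c ih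
  rw [gen_eq_gmap_join]
  have hHc := hH c
  have hSc := hS c
  unfold Pedigree.HeadOldest at hHc
  unfold Pedigree.TailSortedR at hSc
  unfold Pedigree.partsGen at hHc hSc ⊢
  cases hps : P.parts c with
  | nil => simp only [Pedigree.partsGenAux_nil, Pedigree.join, gmap]; exact Canon.born _ _
  | cons p ps =>
      rw [hps] at hHc hSc
      rw [Pedigree.partsGenAux_cons] at hHc hSc ⊢
      have hsub : ∀ q ∈ p :: ps, q ∈ P.parts c := fun q hq => by rw [hps]; exact hq
      cases ps with
      | nil =>
          simp only [Pedigree.partsGenAux_nil, Pedigree.join, chainMerge_nil]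
          exact (hpart 0 p (hsub p List.mem_cons_self)).1
      | cons p' ps' =>
          simp only [Pedigree.join]
          rw [gmap_chainMerge, fst_comp_merLab]
          have hmem : ∀ H ∈ P.partsGenAux c P.genT (0 + 1) (p' :: ps'), ∃ k, ∃ q ∈ P.parts c,
              H = P.partGen c P.genT (0 + 1 + k) q := fun H hH => by
            obtain ⟨k, q, hq, rfl⟩ := P.mem_partsGenAux hH
            exact ⟨k, q, hsub q (List.mem_cons_of_mem _ hq), rfl⟩
          refine Canon.chain (P.step c) _ _ (by simp) (hpart 0 p (hsub p List.mem_cons_self)).1 ?_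
            (hpart 0 p (hsub p List.mem_cons_self)).2 ?_ ?_ (hSc _ _ rfl)
          · intro q hq
            obtain ⟨H, hH, rfl⟩ := List.mem_map.1 hq
            obtain ⟨k, q', hq', rfl⟩ := hmem H hH
            exact (hpart _ q' hq').1
          · intro q hq
            obtain ⟨H, hH, rfl⟩ := List.mem_map.1 hq
            obtain ⟨k, q', hq', rfl⟩ := hmem H hH
            exact (hpart _ q' hq').2
          · intro q hq
            obtain ⟨H, hH, rfl⟩ := List.mem_map.1 hq
            rw [rootStep_gmap, rootStep_gmap]
            exact (hHc _ _ rfl).1 H hH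
termination_by P.step c
decreasing_by assumption

/-- `Mono` of the flat genealogy from «oldest line first» [folklore] -/
theorem mono_gen [DecidableEq α] [DecidableEq π] (hH : ∀ c, P.HeadOldest c) (c : α) : Mono PEv.step (P.gen c) := by
  have h := mono_relabel Prod.fst (st := PEv.step ∘ Prod.fst) (st' := PEv.step) (fun _ => rfl) (mono_genT P hH c)
  rwa [Pedigree.relabel_eq_gmap'] at h

/-- **THE END ON A CANONICALLY WRITTEN PEDIGREE — NO ORDER DISPLAY**: under `HeadOldest`, `TailSortedR`, `RenewDated`,
`ENT PEv.step (P.gen c) ≤ 2·bsum (1 + fat) (P.gen c) + 4·partnerAges PEv.step (P.gen c) + 8·mrg PEv.step (P.gen c)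
+ 8·NR PEv.step (P.gen c)`. [folklore] -/
theorem ENT_leR_gen [DecidableEq α] [DecidableEq π] (hH : ∀ c, P.HeadOldest c) (hS : ∀ c, P.TailSortedR c)
    (hR : P.RenewDated) (c : α) :
    ENT PEv.step (P.gen c) ≤
      2 * bsum (fun b => (1 : ℝ) + PEv.fat b) (P.gen c) + 4 * (partnerAges PEv.step (P.gen c) : ℝ) +
        8 * mrg PEv.step (P.gen c) + 8 * (NR PEv.step (P.gen c) : ℝ) :=
  ENT_leR _ PEv.fat _ (mono_gen P hH c) (injPartsR_of_canon (canon_gen P hH hS hR c))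

end

end Summit.QuantumFields.BalabanUV.T4Continuum.HistorySiblingEntropyBridge
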